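import Literature.AlgebraicGeometry.HodgeTheory.PicardLefschetzNodalForms
import Literature.AlgebraicGeometry.HodgeTheory.SmoothHypersurfaceAtlas
import Literature.AlgebraicGeometry.Motives.GeneralNonsingularForms
import HarnessLib

/-!
# The members of a pencil near a nodal member are nonsingular (clause (i) of the Picard–Lefschetz
# facts `picardLefschetz_nodalForms{,_equivariant,_uniform}` — PROVED)

Family `hodge`, layer `Literature/AlgebraicGeometry/HodgeTheory`, next to `PicardLefschetzNodalForms` (whose
vocabulary `IsOrdinaryDoublePointOf`, `IsNodalFormWithNodes` is used verbatim).  Written by the prover seat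
`hodge-nonav-prover-Bx` (g12, cell `hodge-nonav`) towards the Picard–Lefschetz binders hPL
(`picardLefschetz_nodalForms_uniform`) and hB2 (`picardLefschetz_symmetricA3`) of crux K1-B of
`Summits/HodgeConjecture/HodgeConjecture/Theses/SignSymmetricPowers.lean` (stmt-HodgeConjecture-19716): each of
the three Picard–Lefschetz named facts of `PicardLefschetzNodalForms` begins with the clause
"`∃ ε₀ > 0, ∀ c ≠ 0, |c| < ε₀ → f₁ + c g` is a nonsingular form" for a nodal form `f₁` and a form `g` of the
same degree missing the nodes (Voisin II §2.3.1–2.3.2: the nodal members of a Lefschetz pencil are isolated in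
the discriminant; AGZV II §1.3: a Morse critical point has non-zero critical value after a perturbation which
does not vanish at it).  This file PROVES that clause.

## The argument (elementary; no implicit function theorem)

Let `p` be an ordinary double point of the degree-`d` form `f₁` (`∇f₁(p) = 0`, Hessian `H(p)` of rank `n + 1`,
so `ker H(p) = ℂ p` by Euler) and `g(p) ≠ 0`.  Fix a coordinate `m` with `p_m ≠ 0` and work on the affine
slice `p + y`, `y_m = 0`, which is transversal to the line `ℂ p`: on it the Hessian is injective, so
`‖∇f₁(p + y)‖ ≥ m₀ ‖y‖` for small `y` (`§2`, differentiability of polynomial maps +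
finite-dimensional anti-Lipschitz bound), while `|f₁(p + y)| ≤ C ‖y‖²` (mean value inequality, the gradient
being `O(‖y‖)`).  If `p + y` were a singular zero of `f₁ + c g` then `∇f₁ = −c ∇g` forces `‖y‖ ≤ K |c|`, and
`f₁ = −c g` forces `|c| |g(p + y)| ≤ C K² |c|²`, i.e. `|g(p)|/2 ≤ C K² |c|` — impossible for small `c ≠ 0`
(`§3`).  Globally (`§4`): the set of `c` for which `f₁ + c g` has a singular zero OUTSIDE the (open,
homothety-stable) slice neighbourhoods of the node lines is closed (projection along the compact unit sphere,
`Motives.UniversalHypersurface.isClosed_setOf_exists_ne_zero`) and misses `c = 0` (every singular point of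
`f₁` is a node), hence misses a disc around `0`; inside the neighbourhoods the local statement applies after
rescaling into the slice.

## Main statement

* `IsNodalFormWithNodes.exists_isNonsingularForm_add_smul` — for `f₁, g` homogeneous of degree `d ≥ 1`,
  `f₁` nodal with nodes `p₁, …, p_k` and `g(pᵢ) ≠ 0` for all `i`:
  `∃ ε₀ > 0, ∀ c : ℂ, c ≠ 0 → ‖c‖ < ε₀ → IsNonsingularForm ℂ (f₁ + c • g)` — clause (i) of
  `picardLefschetz_nodalForms`, `picardLefschetz_nodalForms_equivariant`, `picardLefschetz_nodalForms_uniform`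
  VERBATIM.

## References

* [VoisinHodgeII2003] C. Voisin, Hodge Theory and Complex Algebraic Geometry II, CUP 2003, §2.1.1 (Morse lemma,
  non-degenerate critical points), §2.3.1–2.3.2 (ordinary double points, Lefschetz pencils and their
  discriminant). [cite: VoisinHodgeII2003, §2.3.1 and §2.1.1]
* [ArnoldGuseinzadeVarchenko2012] V. I. Arnold, S. M. Gusein-Zade, A. N. Varchenko, Singularities of
  Differentiable Maps, Volume 2, Birkhäuser 2012, Part I §1.3 (perturbation of a Morse critical point).
* [Hartshorne1977] R. Hartshorne, Algebraic Geometry, I Ex. 5.8 (the Jacobian criterion for forms).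
-/

noncomputable section

open MvPolynomial Metric Topology Filter
open Literature.AlgebraicGeometry.Motives Literature.AlgebraicGeometry.Motives.SmoothHypersurface

namespace Literature.AlgebraicGeometry.HodgeTheory

section HodgeTheory

variable {n : ℕ}

/-! ### §1 The Hessian at an ordinary double point: kernel the node line, injective on a coordinate slice -/

/-- **Euler at a singular point: the node vector is in the kernel of the (transposed) Hessian**,
`Σⱼ pⱼ ∂ⱼ∂ₗ f(p) = (d − 1) ∂ₗ f(p) = 0`. [cite: VoisinHodgeII2003, §2.3.1] -/
theorem IsOrdinaryDoublePointOf.sum_mul_eval_pderiv_pderiv_eq_zero {f : MvPolynomial (Fin (n + 2)) ℂ} {d : ℕ}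
    {p : Fin (n + 2) → ℂ} (hf : f.IsHomogeneous d) (h : IsOrdinaryDoublePointOf f p) (l : Fin (n + 2)) :
    ∑ j, p j * eval p (pderiv j (pderiv l f)) = 0 := by
  rw [sum_mul_eval_pderiv_eq (hf.pderiv (i := l)) p, h.eval_pderiv l, mul_zero]

/-- **The kernel of the transposed Hessian at an ordinary double point is the node line**: a vector killed by
`v ↦ (Σⱼ ∂ⱼ∂ₗ f(p) vⱼ)ₗ` is a multiple of `p` (rank `n + 1` and `p` in the kernel).
[cite: VoisinHodgeII2003, §2.3.1] -/
theorem IsOrdinaryDoublePointOf.exists_smul_eq_of_hessian_mulVec_eq_zero {f : MvPolynomial (Fin (n + 2)) ℂ}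
    {d : ℕ} {p : Fin (n + 2) → ℂ} (hf : f.IsHomogeneous d) (h : IsOrdinaryDoublePointOf f p)
    {v : Fin (n + 2) → ℂ}
    (hv : ∀ l, ∑ j, eval p (pderiv j (pderiv l f)) * v j = 0) : ∃ t : ℂ, t • p = v := by
  classical
  set A : Matrix (Fin (n + 2)) (Fin (n + 2)) ℂ :=
    (Matrix.of fun i j : Fin (n + 2) ↦ eval p (pderiv i (pderiv j f))).transpose with hA
  have hrank : A.rank = n + 1 := by rw [hA, Matrix.rank_transpose]; exact h.rank_hessian
  -- `ker A` is one-dimensional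
  have hsum := LinearMap.finrank_range_add_finrank_ker A.mulVecLin
  have hV : Module.finrank ℂ (Fin (n + 2) → ℂ) = n + 2 := Module.finrank_fin_fun ℂ
  rw [hV] at hsum
  have hrange : Module.finrank ℂ (LinearMap.range A.mulVecLin) = n + 1 := hrank
  have hker : Module.finrank ℂ (LinearMap.ker A.mulVecLin) = 1 := by omega
  -- `p` and `v` lie in the kernel
  have hmem : ∀ w : Fin (n + 2) → ℂ, (∀ l, ∑ j, eval p (pderiv j (pderiv l f)) * w j = 0) →
      w ∈ LinearMap.ker A.mulVecLin := by
    intro w hw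
    rw [LinearMap.mem_ker, Matrix.mulVecLin_apply]
    funext l
    rw [Matrix.mulVec, Pi.zero_apply]
    change ∑ j, A l j * w j = 0
    simp only [hA, Matrix.transpose_apply, Matrix.of_apply]
    exact hw l
  have hp : p ∈ LinearMap.ker A.mulVecLin :=
    hmem p fun l => by
      rw [← h.sum_mul_eval_pderiv_pderiv_eq_zero hf l]
      exact Finset.sum_congr rfl fun j _ => mul_comm _ _
  have hvk : v ∈ LinearMap.ker A.mulVecLin := hmem v hv
  have hp0 : (⟨p, hp⟩ : LinearMap.ker A.mulVecLin) ≠ 0 := fun h0 => h.ne_zero (congrArg Subtype.val h0)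
  obtain ⟨t, ht⟩ := (finrank_eq_one_iff_of_nonzero' _ hp0).1 hker ⟨v, hvk⟩
  exact ⟨t, congrArg Subtype.val ht⟩

/-- **The Hessian is injective on a coordinate slice through the node**: if `p_m ≠ 0`, `v_m = 0` and
`(Σⱼ ∂ⱼ∂ₗ f(p) vⱼ)ₗ = 0` then `v = 0`. [cite: VoisinHodgeII2003, §2.3.1] -/
theorem IsOrdinaryDoublePointOf.eq_zero_of_hessian_mulVec_eq_zero {f : MvPolynomial (Fin (n + 2)) ℂ}
    {d : ℕ} {p : Fin (n + 2) → ℂ} (hf : f.IsHomogeneous d) (h : IsOrdinaryDoublePointOf f p)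
    {m : Fin (n + 2)} (hm : p m ≠ 0) {v : Fin (n + 2) → ℂ} (hvm : v m = 0)
    (hv : ∀ l, ∑ j, eval p (pderiv j (pderiv l f)) * v j = 0) : v = 0 := by
  obtain ⟨t, rfl⟩ := h.exists_smul_eq_of_hessian_mulVec_eq_zero hf hv
  have ht : t = 0 := by
    have := hvm
    rw [Pi.smul_apply, smul_eq_mul] at this
    exact (mul_eq_zero.1 this).resolve_right hm
  rw [ht, zero_smul]

/-! ### §2 The gradient map near a node: differentiability and the two-sided first-order bounds -/

section Local

variable {f g : MvPolynomial (Fin (n + 2)) ℂ} {d : ℕ} {p : Fin (n + 2) → ℂ}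

/- Notation of the proofs below (spelled out, no definitions): the gradient vector of `F` at `z` is
`fun l => eval z (pderiv l F) : Fin (n + 2) → ℂ`, and the transposed Hessian of `f` at `p`, as a continuous
linear map, is `ContinuousLinearMap.pi fun l => evalDeriv (pderiv l f) p`. -/

/-- The transposed Hessian applied: `(Σⱼ ∂ⱼ∂ₗ f(p) vⱼ)ₗ`. [folklore] -/
private theorem hessT_apply (f : MvPolynomial (Fin (n + 2)) ℂ) (p v : Fin (n + 2) → ℂ) (l : Fin (n + 2)) :
    (ContinuousLinearMap.pi fun l => evalDeriv (pderiv l f) p) v l = ∑ j, eval p (pderiv j (pderiv l f)) * v j := by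
  simp [evalDeriv_apply]

/-- The translated gradient map `y ↦ ∇f(p + y)` is differentiable at `0` with derivative the transposed
Hessian. [folklore] -/
private theorem hasFDerivAt_grad_translate (f : MvPolynomial (Fin (n + 2)) ℂ) (p : Fin (n + 2) → ℂ) :
    HasFDerivAt (fun (y : Fin (n + 2) → ℂ) (l : Fin (n + 2)) => eval (p + y) (pderiv l f))
      (ContinuousLinearMap.pi fun l => evalDeriv (pderiv l f) p) 0 := by
  rw [hasFDerivAt_pi]
  intro l
  have h1 : HasFDerivAt (fun z => eval z (pderiv l f)) (evalDeriv (pderiv l f) (p + 0)) (p + 0) :=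
    hasFDerivAt_mvPolynomial_eval _ _
  have h2 : HasFDerivAt (fun y : Fin (n + 2) → ℂ => p + y) (ContinuousLinearMap.id ℂ _) 0 :=
    (hasFDerivAt_id (0 : Fin (n + 2) → ℂ)).const_add p
  have h := h1.comp (0 : Fin (n + 2) → ℂ) h2
  rw [add_zero, ContinuousLinearMap.comp_id] at h
  exact h

/-- The translated polynomial function `y ↦ F(p + y)` is differentiable with derivative `evalDeriv F (p + y)`.
[folklore] -/
private theorem hasFDerivAt_eval_translate (F : MvPolynomial (Fin (n + 2)) ℂ) (p y : Fin (n + 2) → ℂ) :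
    HasFDerivAt (fun y : Fin (n + 2) → ℂ => eval (p + y) F) (evalDeriv F (p + y)) y := by
  have h1 : HasFDerivAt (fun z => eval z F) (evalDeriv F (p + y)) (p + y) := hasFDerivAt_mvPolynomial_eval _ _
  have h2 : HasFDerivAt (fun y : Fin (n + 2) → ℂ => p + y) (ContinuousLinearMap.id ℂ _) y :=
    (hasFDerivAt_id y).const_add p
  have h := h1.comp y h2
  rw [ContinuousLinearMap.comp_id] at h
  exact h

/-- The operator norm of `evalDeriv F z` is at most `Σₗ |∂ₗF(z)|`, hence at most `(n + 2) ‖∇F(z)‖`. [folklore] -/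
private theorem norm_evalDeriv_le (F : MvPolynomial (Fin (n + 2)) ℂ) (z : Fin (n + 2) → ℂ) :
    ‖evalDeriv F z‖ ≤ (n + 2) * ‖fun l => eval z (pderiv l F)‖ := by
  refine ContinuousLinearMap.opNorm_le_bound _ (by positivity) fun v => ?_
  rw [evalDeriv_apply]
  calc ‖∑ j, eval z (pderiv j F) * v j‖ ≤ ∑ j, ‖eval z (pderiv j F) * v j‖ := norm_sum_le _ _
    _ ≤ ∑ _j : Fin (n + 2), ‖fun l => eval z (pderiv l F)‖ * ‖v‖ := by
        refine Finset.sum_le_sum fun j _ => ?_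
        rw [norm_mul]
        exact mul_le_mul (norm_le_pi_norm (fun l => eval z (pderiv l F)) j) (norm_le_pi_norm v j)
          (norm_nonneg _) (norm_nonneg _)
    _ = (n + 2) * ‖fun l => eval z (pderiv l F)‖ * ‖v‖ := by
        rw [Finset.sum_const, Finset.card_univ, Fintype.card_fin, nsmul_eq_mul]
        push_cast
        ring

/-- **Lower first-order bound on a slice**: at an ordinary double point `p` of `f` with `p_m ≠ 0` there are
`m₀ > 0` and `δ > 0` with `m₀ ‖y‖ ≤ ‖∇f(p + y)‖` for all `y` with `y_m = 0`, `‖y‖ < δ`.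
[cite: VoisinHodgeII2003, §2.1.1 and §2.3.1] -/
private theorem exists_lower_bound_grad (hf : f.IsHomogeneous d) (h : IsOrdinaryDoublePointOf f p)
    {m : Fin (n + 2)} (hm : p m ≠ 0) :
    ∃ m₀ δ : ℝ, 0 < m₀ ∧ 0 < δ ∧ ∀ y : Fin (n + 2) → ℂ, y m = 0 → ‖y‖ < δ →
      m₀ * ‖y‖ ≤ ‖fun l => eval (p + y) (pderiv l f)‖ := by
  -- notation: gradient of `f` translated to the node, and the transposed Hessian
  set grad : (Fin (n + 2) → ℂ) → (Fin (n + 2) → ℂ) := fun y l => eval (p + y) (pderiv l f) with hgrad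
  set hessT : (Fin (n + 2) → ℂ) →L[ℂ] (Fin (n + 2) → ℂ) :=
    ContinuousLinearMap.pi fun l => evalDeriv (pderiv l f) p with hhessT
  -- the slice `W = {y | y_m = 0}` and the restricted Hessian, injective hence anti-Lipschitz
  let W : Submodule ℂ (Fin (n + 2) → ℂ) := LinearMap.ker (LinearMap.proj m)
  let L : W →ₗ[ℂ] (Fin (n + 2) → ℂ) := (hessT : (Fin (n + 2) → ℂ) →ₗ[ℂ] (Fin (n + 2) → ℂ)).domRestrict W
  have hLinj : Function.Injective L := by
    intro w₁ w₂ hw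
    have hsub : L (w₁ - w₂) = 0 := by rw [map_sub, hw, sub_self]
    have hmem : (w₁ - w₂ : W).1 m = 0 := by
      have := (w₁ - w₂).2
      simpa [W] using this
    have hz : ((w₁ - w₂ : W) : Fin (n + 2) → ℂ) = 0 := by
      refine h.eq_zero_of_hessian_mulVec_eq_zero hf hm hmem fun l => ?_
      have := congrFun hsub l
      rw [Pi.zero_apply] at this
      rw [← this]
      exact (hessT_apply f p _ l).symm
    exact sub_eq_zero.1 (Subtype.ext hz)
  obtain ⟨K, hK, hKL⟩ := (LinearMap.injective_iff_antilipschitz L).1 hLinj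
  -- little-o remainder of the gradient at `0`, with constant `1/(2K)`
  have hder : (fun y => grad y - grad 0 - hessT (y - 0)) =o[𝓝 0] fun y => y - 0 :=
    (hasFDerivAt_grad_translate f p).isLittleO
  have hc : (0 : ℝ) < (K : ℝ)⁻¹ / 2 := by positivity
  have hev := hder.def hc
  rw [Metric.eventually_nhds_iff] at hev
  obtain ⟨δ, hδ, hδb⟩ := hev
  refine ⟨(K : ℝ)⁻¹ / 2, δ, hc, hδ, fun y hym hyδ => ?_⟩
  show (K : ℝ)⁻¹ / 2 * ‖y‖ ≤ ‖grad y‖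
  have hgrad0 : grad 0 = 0 := by
    funext l; simp only [hgrad, add_zero]; exact h.eval_pderiv l
  have hb := hδb (by rwa [dist_zero_right])
  rw [hgrad0, sub_zero, sub_zero] at hb
  -- anti-Lipschitz: `‖y‖ ≤ K ‖hessT y‖` on the slice
  have hAL := hKL.le_mul_dist (⟨y, by simpa [W] using hym⟩ : W) 0
  rw [dist_zero_right, map_zero, dist_zero_right] at hAL
  have hLy : L ⟨y, by simpa [W] using hym⟩ = hessT y := rfl
  rw [hLy] at hAL
  have hnorm : ‖(⟨y, by simpa [W] using hym⟩ : W)‖ = ‖y‖ := rfl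
  rw [hnorm] at hAL
  -- combine: ‖hessT y‖ ≤ ‖grad‖ + ‖grad − hessT y‖ ≤ ‖grad‖ + ‖y‖/(2K)
  have hK0 : (0 : ℝ) < K := by exact_mod_cast hK
  have h1 : ‖hessT y‖ ≤ ‖grad y‖ + (K : ℝ)⁻¹ / 2 * ‖y‖ := by
    calc ‖hessT y‖ = ‖grad y - (grad y - hessT y)‖ := by rw [sub_sub_cancel]
      _ ≤ ‖grad y‖ + ‖grad y - hessT y‖ := norm_sub_le _ _
      _ ≤ ‖grad y‖ + (K : ℝ)⁻¹ / 2 * ‖y‖ := by gcongr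
  have h2 : ‖y‖ ≤ K * ‖hessT y‖ := hAL
  have h3 : (K : ℝ)⁻¹ * ‖y‖ ≤ ‖hessT y‖ := by
    rw [inv_mul_le_iff₀ hK0]; exact h2
  linarith

/-- **Upper first-order bound**: `‖∇f(p + y)‖ ≤ C₁ ‖y‖` for `‖y‖ < δ`, at a point `p` where `∇f(p) = 0`.
[cite: VoisinHodgeII2003, §2.1.1] -/
private theorem exists_upper_bound_grad (h : IsOrdinaryDoublePointOf f p) :
    ∃ C₁ δ : ℝ, 0 < C₁ ∧ 0 < δ ∧ ∀ y : Fin (n + 2) → ℂ, ‖y‖ < δ →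
      ‖fun l => eval (p + y) (pderiv l f)‖ ≤ C₁ * ‖y‖ := by
  set grad : (Fin (n + 2) → ℂ) → (Fin (n + 2) → ℂ) := fun y l => eval (p + y) (pderiv l f) with hgrad
  set hessT : (Fin (n + 2) → ℂ) →L[ℂ] (Fin (n + 2) → ℂ) :=
    ContinuousLinearMap.pi fun l => evalDeriv (pderiv l f) p with hhessT
  have hder : (fun y => grad y - grad 0 - hessT (y - 0)) =o[𝓝 0] fun y => y - 0 :=
    (hasFDerivAt_grad_translate f p).isLittleO
  have hev := hder.def zero_lt_one
  rw [Metric.eventually_nhds_iff] at hev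
  obtain ⟨δ, hδ, hδb⟩ := hev
  refine ⟨‖hessT‖ + 1, δ, by positivity, hδ, fun y hyδ => ?_⟩
  show ‖grad y‖ ≤ (‖hessT‖ + 1) * ‖y‖
  have hgrad0 : grad 0 = 0 := by
    funext l; simp only [hgrad, add_zero]; exact h.eval_pderiv l
  have hb := hδb (by rwa [dist_zero_right])
  rw [hgrad0, sub_zero, sub_zero, one_mul] at hb
  calc ‖grad y‖ = ‖hessT y + (grad y - hessT y)‖ := by rw [add_sub_cancel]
    _ ≤ ‖hessT y‖ + ‖grad y - hessT y‖ := norm_add_le _ _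
    _ ≤ ‖hessT‖ * ‖y‖ + ‖y‖ := by gcongr; exact ContinuousLinearMap.le_opNorm _ _
    _ = (‖hessT‖ + 1) * ‖y‖ := by ring

/-- **Second-order bound on the values**: `|f(p + y)| ≤ C₂ ‖y‖²` for `‖y‖ < δ` at an ordinary double point `p`
of the form `f` of degree `d ≥ 1` (mean value inequality on the segment, the derivative being `O(‖y‖)`).
[cite: VoisinHodgeII2003, §2.1.1 (Morse lemma)] -/
private theorem exists_sq_bound_eval (hf : f.IsHomogeneous d) (hd : 1 ≤ d) (h : IsOrdinaryDoublePointOf f p) :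
    ∃ C₂ δ : ℝ, 0 < C₂ ∧ 0 < δ ∧ ∀ y : Fin (n + 2) → ℂ, ‖y‖ < δ → ‖eval (p + y) f‖ ≤ C₂ * ‖y‖ ^ 2 := by
  obtain ⟨C₁, δ, hC₁, hδ, hb⟩ := exists_upper_bound_grad h
  refine ⟨(n + 2) * C₁, δ, by positivity, hδ, fun y hyδ => ?_⟩
  have hf0 : eval (p + 0) f = 0 := by rw [add_zero]; exact h.eval_eq_zero hf hd
  -- mean value inequality on the closed ball of radius ‖y‖ (convex, inside the ball of radius δ)
  have hMV := Convex.norm_image_sub_le_of_norm_hasFDerivWithin_le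
    (f := fun y : Fin (n + 2) → ℂ => eval (p + y) f) (f' := fun y => evalDeriv f (p + y))
    (s := Metric.closedBall (0 : Fin (n + 2) → ℂ) ‖y‖) (C := (n + 2) * C₁ * ‖y‖)
    (fun x _ => (hasFDerivAt_eval_translate f p x).hasFDerivWithinAt)
    (fun x hx => by
      rw [Metric.mem_closedBall, dist_zero_right] at hx
      calc ‖evalDeriv f (p + x)‖ ≤ (n + 2) * ‖fun l => eval (p + x) (pderiv l f)‖ := norm_evalDeriv_le f (p + x)
        _ ≤ (n + 2) * (C₁ * ‖x‖) := by gcongr; exact hb x (lt_of_le_of_lt hx hyδ)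
        _ ≤ (n + 2) * (C₁ * ‖y‖) := by gcongr
        _ = (n + 2) * C₁ * ‖y‖ := by ring)
    (convex_closedBall _ _) (Metric.mem_closedBall_self (norm_nonneg y))
    (by rw [Metric.mem_closedBall, dist_zero_right])
  rw [hf0, sub_zero, sub_zero] at hMV
  calc ‖eval (p + y) f‖ ≤ (n + 2) * C₁ * ‖y‖ * ‖y‖ := hMV
    _ = (n + 2) * C₁ * ‖y‖ ^ 2 := by ring

/-! ### §3 The local statement: no singular zero of `f + c g` on the slice near the node, `0 < |c| < ε` -/

/-- **A perturbed Morse point carries no singular zero.**  At an ordinary double point `p` of the form `f` of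
degree `d ≥ 1` with `g(p) ≠ 0` and a coordinate `m` with `p_m ≠ 0`: there are `ρ, ε > 0` such that for
`0 < |c| < ε` no point `p + y` of the slice `y_m = 0`, `‖y‖ < ρ`, is a common zero of `f + c g` and all its
partials.  [cite: ArnoldGuseinzadeVarchenko2012, Part I §1.3] [cite: VoisinHodgeII2003, §2.3.1–2.3.2] -/
theorem IsOrdinaryDoublePointOf.exists_forall_not_singular_add_smul (hf : f.IsHomogeneous d) (hd : 1 ≤ d)
    (h : IsOrdinaryDoublePointOf f p) (hgp : eval p g ≠ 0) {m : Fin (n + 2)} (hm : p m ≠ 0) :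
    ∃ ρ ε : ℝ, 0 < ρ ∧ 0 < ε ∧ ∀ c : ℂ, c ≠ 0 → ‖c‖ < ε → ∀ y : Fin (n + 2) → ℂ, y m = 0 → ‖y‖ < ρ →
      ¬ (eval (p + y) (f + c • g) = 0 ∧ ∀ j, eval (p + y) (pderiv j (f + c • g)) = 0) := by
  obtain ⟨m₀, δ₁, hm₀, hδ₁, hlow⟩ := exists_lower_bound_grad hf h hm
  obtain ⟨C₂, δ₂, hC₂, hδ₂, hsq⟩ := exists_sq_bound_eval hf hd h
  -- notation: the gradients of `f` and `g` translated to the node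
  set gradf : (Fin (n + 2) → ℂ) → (Fin (n + 2) → ℂ) := fun y l => eval (p + y) (pderiv l f) with hgradf
  set gradg : (Fin (n + 2) → ℂ) → (Fin (n + 2) → ℂ) := fun y l => eval (p + y) (pderiv l g) with hgradg
  -- a bound for `∇g` on the closed unit ball around `p`
  have hcont : Continuous gradg := by
    refine continuous_pi fun l => ?_
    exact (MvPolynomial.continuous_eval (pderiv l g)).comp (continuous_const.add continuous_id)
  obtain ⟨Mg, hMg⟩ := (isCompact_closedBall (0 : Fin (n + 2) → ℂ) 1).exists_bound_of_continuousOn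
    hcont.continuousOn
  have hMg0 : 0 ≤ Mg := le_trans (norm_nonneg _) (hMg 0 (Metric.mem_closedBall_self zero_le_one))
  -- continuity of `g` at `p`: `|g(p + y)| ≥ |g(p)|/2` near `0`
  have hgcont : Continuous fun y : Fin (n + 2) → ℂ => eval (p + y) g :=
    (MvPolynomial.continuous_eval g).comp (continuous_const.add continuous_id)
  have hgp0 : 0 < ‖eval p g‖ := norm_pos_iff.2 hgp
  obtain ⟨δ₃, hδ₃, hδ₃b⟩ := Metric.continuous_iff.1 hgcont 0 (‖eval p g‖ / 2) (by positivity)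
  -- constants
  set K : ℝ := Mg / m₀ with hK
  set ε : ℝ := ‖eval p g‖ / (2 * (C₂ * K ^ 2 + 1)) with hε
  have hε0 : 0 < ε := by positivity
  refine ⟨min (min δ₁ δ₂) (min δ₃ 1), ε, by positivity, hε0, fun c hc hcε y hym hyρ ⟨hval, hder⟩ => ?_⟩
  have hy₁ : ‖y‖ < δ₁ := lt_of_lt_of_le hyρ (le_trans (min_le_left _ _) (min_le_left _ _))
  have hy₂ : ‖y‖ < δ₂ := lt_of_lt_of_le hyρ (le_trans (min_le_left _ _) (min_le_right _ _))
  have hy₃ : ‖y‖ < δ₃ := lt_of_lt_of_le hyρ (le_trans (min_le_right _ _) (min_le_left _ _))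
  have hy1 : ‖y‖ ≤ 1 := (lt_of_lt_of_le hyρ (le_trans (min_le_right _ _) (min_le_right _ _))).le
  have hc0 : 0 < ‖c‖ := norm_pos_iff.2 hc
  -- (1) the gradient equation: `∇f(p+y) = −c ∇g(p+y)`, so `m₀ ‖y‖ ≤ |c| Mg`, `‖y‖ ≤ K |c|`
  have hgradeq : gradf y = -(c • gradg y) := by
    funext l
    have := hder l
    rw [map_add, Derivation.map_smul, map_add, smul_eval] at this
    simp only [hgradf, hgradg, Pi.neg_apply, Pi.smul_apply, smul_eq_mul]
    linear_combination this
  have hyle : ‖y‖ ≤ K * ‖c‖ := by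
    have h1 : m₀ * ‖y‖ ≤ ‖gradf y‖ := hlow y hym hy₁
    rw [hgradeq, norm_neg, norm_smul] at h1
    have h2 : ‖gradg y‖ ≤ Mg := hMg y (by rwa [Metric.mem_closedBall, dist_zero_right])
    have h3 : m₀ * ‖y‖ ≤ ‖c‖ * Mg := le_trans h1 (by gcongr)
    rw [hK]
    rw [div_mul_eq_mul_div, le_div_iff₀ hm₀]
    linarith
  -- (2) the value equation: `f(p+y) = −c g(p+y)`, so `|c| |g(p+y)| ≤ C₂ ‖y‖² ≤ C₂ K² |c|²`
  have hvaleq : eval (p + y) f = -(c * eval (p + y) g) := by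
    rw [map_add, smul_eval] at hval
    linear_combination hval
  have hgy : ‖eval p g‖ / 2 ≤ ‖eval (p + y) g‖ := by
    have hd3 := hδ₃b y (by rwa [dist_zero_right])
    rw [add_zero, dist_eq_norm, norm_sub_rev] at hd3
    have := norm_sub_norm_le (eval p g) (eval (p + y) g)
    linarith
  have hmain : ‖c‖ * ‖eval (p + y) g‖ ≤ C₂ * (K * ‖c‖) ^ 2 := by
    have h1 := hsq y hy₂
    rw [hvaleq, norm_neg, norm_mul] at h1
    exact le_trans h1 (by gcongr)
  -- divide by `|c| > 0`: `|g(p)|/2 ≤ C₂ K² |c| < C₂ K² ε ≤ |g(p)|/2`, contradiction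
  have h4 : ‖eval (p + y) g‖ ≤ C₂ * K ^ 2 * ‖c‖ := by
    have : ‖c‖ * ‖eval (p + y) g‖ ≤ ‖c‖ * (C₂ * K ^ 2 * ‖c‖) := by
      calc ‖c‖ * ‖eval (p + y) g‖ ≤ C₂ * (K * ‖c‖) ^ 2 := hmain
        _ = ‖c‖ * (C₂ * K ^ 2 * ‖c‖) := by ring
    exact le_of_mul_le_mul_left this hc0
  have h5 : ‖eval p g‖ / 2 ≤ C₂ * K ^ 2 * ‖c‖ := le_trans hgy h4
  have h6 : C₂ * K ^ 2 * ‖c‖ < C₂ * K ^ 2 * ε + ε := by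
    have : C₂ * K ^ 2 * ‖c‖ ≤ C₂ * K ^ 2 * ε := by gcongr
    linarith
  have h7 : C₂ * K ^ 2 * ε + ε = ‖eval p g‖ / 2 := by
    rw [hε]; field_simp
  linarith

end Local

/-! ### §4 Globalisation: the pencil members `f₁ + c g`, `0 < |c| < ε₀`, are nonsingular -/

section Global

variable {d k : ℕ} {f₁ g : MvPolynomial (Fin (n + 2)) ℂ} {p : Fin k → Fin (n + 2) → ℂ}

/-- Rescaling a common zero of `F` and its partials (homogeneity): `t • z` is again one. [folklore] -/
private theorem singular_smul {F : MvPolynomial (Fin (n + 2)) ℂ} {e : ℕ} (hF : F.IsHomogeneous e) (t : ℂ)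
    {z : Fin (n + 2) → ℂ} (hz : eval z F = 0 ∧ ∀ j, eval z (pderiv j F) = 0) :
    eval (t • z) F = 0 ∧ ∀ j, eval (t • z) (pderiv j F) = 0 := by
  refine ⟨?_, fun j => ?_⟩
  · rw [UniversalHypersurface.eval_smul_of_isHomogeneous n hF, hz.1, mul_zero]
  · rw [UniversalHypersurface.eval_smul_of_isHomogeneous n (hF.pderiv (i := j)), hz.2 j, mul_zero]

/-- The pencil member `f₁ + c • g` is homogeneous of degree `d`. [folklore] -/
private theorem isHomogeneous_add_smul (hf₁ : f₁.IsHomogeneous d) (hg : g.IsHomogeneous d) (c : ℂ) :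
    (f₁ + c • g).IsHomogeneous d :=
  hf₁.add (by rw [MvPolynomial.smul_eq_C_mul]; exact hg.C_mul c)

/-- **Clause (i) of the Picard–Lefschetz facts, PROVED: the members of the pencil `f₁ + c g` near a nodal
member are nonsingular.**  Let `f₁, g` be forms of degree `d ≥ 1` on `ℙⁿ⁺¹_ℂ`, `f₁` nodal with nodes
`[p₁], …, [p_k]` (`IsNodalFormWithNodes`: ordinary double points, and every singular point is one of them) and
`g(pᵢ) ≠ 0` for all `i`.  Then there is `ε₀ > 0` such that `f₁ + c g` is a nonsingular form
(`SmoothHypersurface.IsNonsingularForm`) for every `0 < |c| < ε₀`.  This is VERBATIM the first clause of the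
named facts `picardLefschetz_nodalForms`, `picardLefschetz_nodalForms_equivariant`,
`picardLefschetz_nodalForms_uniform` (Voisin II §2.3.1–2.3.2: the nodal members are isolated points of the
discriminant curve of the pencil; AGZV II §1.3).  Proof: near each node, on a coordinate slice transversal to
the node line, a singular zero `p + y` of `f₁ + c g` would satisfy `‖y‖ ≤ K|c|` (gradient equation, Hessian
injective on the slice) and `|c| |g| ≤ C ‖y‖²` (value equation), impossible for small `c ≠ 0`
(`IsOrdinaryDoublePointOf.exists_forall_not_singular_add_smul`); away from the nodes, the parameters `c`
with a singular zero outside the homothety-stable slice neighbourhoods form a closed set not containing `0`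
(projection along the compact unit sphere).  [cite: VoisinHodgeII2003, §2.3.1 and §2.3.2]
[cite: ArnoldGuseinzadeVarchenko2012, Part I §1.3] [cite: Hartshorne1977, I Ex. 5.8] -/
theorem IsNodalFormWithNodes.exists_isNonsingularForm_add_smul (hd : 1 ≤ d) (hf₁ : f₁.IsHomogeneous d)
    (hg : g.IsHomogeneous d) (hnod : IsNodalFormWithNodes f₁ p) (hgp : ∀ i, eval (p i) g ≠ 0) :
    ∃ ε₀ : ℝ, 0 < ε₀ ∧
      ∀ c : ℂ, c ≠ 0 → ‖c‖ < ε₀ → SmoothHypersurface.IsNonsingularForm ℂ (f₁ + c • g) := by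
  classical
  -- a coordinate with `pᵢ_m ≠ 0` for each node, and the local data
  have hm : ∀ i, ∃ m : Fin (n + 2), p i m ≠ 0 := fun i => Function.ne_iff.1 (hnod.1 i).ne_zero
  choose m hm using hm
  have hloc := fun i => (hnod.1 i).exists_forall_not_singular_add_smul (g := g) hf₁ hd (hgp i) (hm i)
  choose ρ ε hρ hε hloc using hloc
  -- the homothety-stable slice neighbourhoods of the node lines
  let U : Fin k → Set (Fin (n + 2) → ℂ) := fun i =>
    {w | w (m i) ≠ 0 ∧ ‖((p i (m i)) / (w (m i))) • w - p i‖ < ρ i}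
  have hUopen : ∀ i, IsOpen (U i) := by
    intro i
    have hS : IsOpen {w : Fin (n + 2) → ℂ | w (m i) ≠ 0} :=
      isOpen_ne_fun (continuous_apply (m i)) continuous_const
    refine isOpen_iff_mem_nhds.2 fun w hw => ?_
    obtain ⟨hw0, hwρ⟩ := hw
    have hca : ContinuousAt (fun w : Fin (n + 2) → ℂ => ‖((p i (m i)) / (w (m i))) • w - p i‖) w :=
      (((continuousAt_const.div ((continuous_apply (m i)).continuousAt) hw0).smul continuousAt_id).sub
        continuousAt_const).norm
    have h1 : ∀ᶠ w' in 𝓝 w, w' (m i) ≠ 0 := hS.mem_nhds hw0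
    have h2 : ∀ᶠ w' in 𝓝 w, ‖((p i (m i)) / (w' (m i))) • w' - p i‖ < ρ i :=
      hca.eventually_mem (Iio_mem_nhds hwρ)
    exact h1.and h2
  have hUsmul : ∀ i (t : ℂ), t ≠ 0 → ∀ w ∈ U i, t • w ∈ U i := by
    intro i t ht w hw
    obtain ⟨hw0, hwρ⟩ := hw
    refine ⟨by rw [Pi.smul_apply, smul_eq_mul]; exact mul_ne_zero ht hw0, ?_⟩
    have : ((p i (m i)) / ((t • w) (m i))) • (t • w) = ((p i (m i)) / (w (m i))) • w := by
      rw [Pi.smul_apply, smul_eq_mul, smul_smul]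
      congr 1
      field_simp
    rw [this]; exact hwρ
  have hUline : ∀ i (s : ℂ), s ≠ 0 → s • p i ∈ U i := by
    intro i s hs
    refine ⟨by rw [Pi.smul_apply, smul_eq_mul]; exact mul_ne_zero hs (hm i), ?_⟩
    have : ((p i (m i)) / ((s • p i) (m i))) • (s • p i) = p i := by
      rw [Pi.smul_apply, smul_eq_mul, smul_smul]
      have : p i (m i) / (s * p i (m i)) * s = 1 := by
        rw [div_mul_eq_mul_div, mul_comm s (p i (m i)), div_self (mul_ne_zero (hm i) hs)]
      rw [this, one_smul]
    rw [this, sub_self, norm_zero]; exact hρ i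
  -- inside `U i`: rescale into the slice and apply the local statement
  have hin : ∀ i (c : ℂ), c ≠ 0 → ‖c‖ < ε i → ∀ z ∈ U i,
      ¬ (eval z (f₁ + c • g) = 0 ∧ ∀ j, eval z (pderiv j (f₁ + c • g)) = 0) := by
    intro i c hc hcε z hz hsing
    obtain ⟨hz0, hzρ⟩ := hz
    set t : ℂ := (p i (m i)) / (z (m i)) with ht
    set y : Fin (n + 2) → ℂ := t • z - p i with hy
    have hym : y (m i) = 0 := by
      rw [hy, Pi.sub_apply, Pi.smul_apply, smul_eq_mul, ht, div_mul_cancel₀ _ hz0, sub_self]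
    have hty : p i + y = t • z := by rw [hy, add_sub_cancel]
    have hsing' := singular_smul (isHomogeneous_add_smul hf₁ hg c) t hsing
    rw [← hty] at hsing'
    exact hloc i c hc hcε y hym hzρ hsing'
  -- outside the `U i`: the bad parameters form a closed set missing `0`
  let Uall : Set (Fin (n + 2) → ℂ) := ⋃ i, U i
  have hUall : IsOpen Uall := isOpen_iUnion hUopen
  let P : ℂ → (Fin (n + 2) → ℂ) → Prop := fun c z =>
    (eval z f₁ + c * eval z g = 0 ∧ ∀ j, eval z (pderiv j f₁) + c * eval z (pderiv j g) = 0) ∧ z ∉ Uall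
  have hPclosed : IsClosed {q : ℂ × (Fin (n + 2) → ℂ) | P q.1 q.2} := by
    have e : {q : ℂ × (Fin (n + 2) → ℂ) | P q.1 q.2} =
        ((fun q : ℂ × (Fin (n + 2) → ℂ) => eval q.2 f₁ + q.1 * eval q.2 g) ⁻¹' {0} ∩
          ⋂ j, (fun q : ℂ × (Fin (n + 2) → ℂ) => eval q.2 (pderiv j f₁) + q.1 * eval q.2 (pderiv j g)) ⁻¹' {0}) ∩
          Prod.snd ⁻¹' Uallᶜ := by
      ext q
      simp only [P, Set.mem_setOf_eq, Set.mem_inter_iff, Set.mem_preimage, Set.mem_singleton_iff,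
        Set.mem_iInter, Set.mem_compl_iff]
    rw [e]
    have hc : ∀ F G : MvPolynomial (Fin (n + 2)) ℂ,
        Continuous fun q : ℂ × (Fin (n + 2) → ℂ) => eval q.2 F + q.1 * eval q.2 G := fun F G =>
      ((MvPolynomial.continuous_eval F).comp continuous_snd).add
        (continuous_fst.mul ((MvPolynomial.continuous_eval G).comp continuous_snd))
    exact ((isClosed_singleton.preimage (hc f₁ g)).inter
      (isClosed_iInter fun j => isClosed_singleton.preimage (hc _ _))).inter
      (hUall.isClosed_compl.preimage continuous_snd)
  have hPscale : ∀ c z (t : ℝ), 0 < t → P c z → P c ((t : ℂ) • z) := by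
    rintro c z t ht ⟨⟨hzF, hzd⟩, hzU⟩
    refine ⟨⟨?_, fun j => ?_⟩, fun hmem => hzU ?_⟩
    · rw [UniversalHypersurface.eval_smul_of_isHomogeneous n hf₁,
        UniversalHypersurface.eval_smul_of_isHomogeneous n hg, mul_left_comm, ← mul_add, hzF, mul_zero]
    · rw [UniversalHypersurface.eval_smul_of_isHomogeneous n (hf₁.pderiv (i := j)),
        UniversalHypersurface.eval_smul_of_isHomogeneous n (hg.pderiv (i := j)), mul_left_comm, ← mul_add,
        hzd j, mul_zero]
    · obtain ⟨i, hi⟩ := Set.mem_iUnion.1 hmem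
      have ht0 : ((t : ℂ))⁻¹ ≠ 0 := inv_ne_zero (by exact_mod_cast ht.ne')
      have := hUsmul i _ ht0 _ hi
      rw [smul_smul, inv_mul_cancel₀ (by exact_mod_cast ht.ne'), one_smul] at this
      exact Set.mem_iUnion.2 ⟨i, this⟩
  have hBclosed := UniversalHypersurface.isClosed_setOf_exists_ne_zero P hPclosed hPscale
  have h0B : (0 : ℂ) ∉ {c : ℂ | ∃ z : Fin (n + 2) → ℂ, z ≠ 0 ∧ P c z} := by
    rintro ⟨z, hz, ⟨hzF, hzd⟩, hzU⟩
    simp only [zero_mul, add_zero] at hzd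
    obtain ⟨i, s, rfl⟩ := hnod.2.2 z hz hzd
    have hs : s ≠ 0 := by rintro rfl; exact hz (zero_smul _ _)
    exact hzU (Set.mem_iUnion.2 ⟨i, hUline i s hs⟩)
  obtain ⟨εA, hεA, hεAB⟩ := Metric.isOpen_iff.1 hBclosed.isOpen_compl 0 h0B
  -- a common radius below all the `ε i`
  let εB : ℝ := if hk : (Finset.univ : Finset (Fin k)).Nonempty then Finset.univ.inf' hk ε else 1
  have hεB : 0 < εB := by
    simp only [εB]
    split_ifs with hk
    · exact (Finset.lt_inf'_iff hk).2 fun i _ => hε i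
    · exact zero_lt_one
  have hεBle : ∀ i, εB ≤ ε i := by
    intro i
    have hk : (Finset.univ : Finset (Fin k)).Nonempty := ⟨i, Finset.mem_univ i⟩
    simp only [εB, dif_pos hk]
    exact Finset.inf'_le _ (Finset.mem_univ i)
  refine ⟨min εA εB, lt_min hεA hεB, fun c hc hcε => ?_⟩
  refine isNonsingularForm_of_forall_exists_eval_pderiv_ne_zero fun z hz hFz => ?_
  by_contra hall
  push Not at hall
  by_cases hzU : z ∈ Uall
  · obtain ⟨i, hi⟩ := Set.mem_iUnion.1 hzU
    exact hin i c hc (lt_of_lt_of_le hcε (le_trans (min_le_right _ _) (hεBle i))) z hi ⟨hFz, hall⟩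
  · have hcB : c ∈ Metric.ball (0 : ℂ) εA := by
      rw [Metric.mem_ball, dist_zero_right]; exact lt_of_lt_of_le hcε (min_le_left _ _)
    have := hεAB hcB
    refine this ⟨z, hz, ⟨?_, fun j => ?_⟩, hzU⟩
    · rw [map_add, smul_eval] at hFz; exact hFz
    · have := hall j
      rw [map_add, Derivation.map_smul, map_add, smul_eval] at this
      exact this

end Global

end HodgeTheory

end Literature.AlgebraicGeometry.HodgeTheory

end
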